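import Summits.BirchSwinnertonDyer.BirchSwinnertonDyer.Theses.SmallImageMuTransfer
import Summits.BirchSwinnertonDyer.BirchSwinnertonDyer.Theorems.Rank1ResidualX9MuTransfer
import Literature.NumberTheory.EllipticCurves.EmertonPollackWeston2006.MuAnTransferGoodOrdinary
import Literature.NumberTheory.EllipticCurves.GreenbergVatsal2000.CongruentCurves
import Literature.NumberTheory.EllipticCurves.ComplexMultiplication
import Literature.NumberTheory.EllipticCurves.ModularCurvePeriodRatio
import Literature.NumberTheory.EllipticCurves.Rank1Residual.X9MuInvariant
import Summits.BirchSwinnertonDyer.BirchSwinnertonDyer.Theorems.SmallImageMuTransferAnalyticMuZeroX9Primes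
import HarnessLib

/-!
# Route `SmallImageMuTransfer` (rung K6), crux `AnalyticMuZeroX9` (stmt-BirchSwinnertonDyer-19630):
# the EXACT STRENGTH of the line of record `d1_byname` (split D1 by item name)

Cell `bsd-smallim`, seat `bsd-line-k6-p1` (LEAD of the crux, gen 2), `--supports
stmt-BirchSwinnertonDyer-19630` helper.  HONEST FRAMING: bookkeeping theorems only (Emerton–Pollack–Weston
2006 Thm. 1 read in BOTH directions along a torsion isomorphism + the period unit); nothing is asserted
about any curve, nothing is booked, the crux (Greenberg's `μ = 0`, LNM 1716 Conj. 1.11, analytic side,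
on class X9) and its two child cruxes stay OPEN.  Beyond print: NO.  BSD is not proved by any of this.

The line of record for the crux (`Cruxes/AnalyticMuZeroX9/Lines/d1_byname.lean`, skeleton b2a7244d) is
the K6 route's glued split D1 BY ITEM NAME,

  `AnalyticMuZeroX9 ⟸ MuZeroCMCurves (19234) ∧ AnalyticMuZeroX9NoCMPartner (19235) ∧ MuSplitInputs (19236)`,

composed by the proved glue `Theorems.smallImageMuTransfer_AnalyticMuZeroX9Split_proof` (p418273).  This
file records how much of each stub the composition CONSUMES and which part is NECESSARY:

* `Theorems.smallImageMuTransfer_analyticMuZeroX9NoCMPartner_of_analyticMuZeroX9` — stub 2 (item 19235)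
  is a literal sub-statement of the crux (`crux → stub 2`, no input): it is exactly as hard as the crux
  on its pairs.
* `Rank1Residual.muAnZero_of_congruent_classX9_of_analyticMuZeroOnClassX9` — the REVERSE transfer:
  modulo EPW Thm. 1 (`hEPW`) and the period unit (`h5`), the crux forces the `ϖ`-normalised
  unit-coefficient certificate on EVERY globally minimal curve `A`, good ordinary at `p`, carrying a
  `Γ_ℚ`-equivariant `A[p] ≃ W[p]` to an X9 pair `(W, p)` — in particular on every CM PARTNER of an X9
  pair.  (EPW along `e⁻¹ : W[p] ≃ A[p]`; irreducibility sits on `W[p]`; the crux is applied to the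
  newform of `W` at level `N_W`, so Carayol is not needed in this direction; `‖ϖ‖_p = 1` by
  `Rank1Residual.norm_periodRatio_eq_one`.)
* `Rank1Residual.analyticMuZeroOnClassX9_of_partneredCMSplit` — the glue seam with stub 1 WEAKENED to
  the PARTNERED CM pairs: the composition only ever evaluates `MuZeroCMCurves` at a CM curve `A` that
  partners some X9 pair `(W, p)` (same proof as the seam `analyticMuZeroOnClassX9_of_cmSplit`, the
  partner witness threaded through).
* `Theorems.smallImageMuTransfer_analyticMuZeroX9_iff_noCMPartner_and_partneredCM` — BY NAME, modulo
  `MuSplitInputs`: `AnalyticMuZeroX9 ↔ AnalyticMuZeroX9NoCMPartner ∧ (MuZeroCMCurves on partnered pairs)`.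

READING FOR THE PLANNER (numbers, not adjectives).  Stub 1 as filed (item 19234: ALL globally minimal
curves with `j ∈ maximalCMJInvariants`, i.e. the nine class-number-one maximal-order CM curves AND all
their twists, at EVERY split prime `p ≥ 5`) is STRONGER than what line `d1_byname` consumes by exactly its
un-partnered instances; the consumed part — CM pairs `(A, p)` congruent mod `p` to an X9 pair — is
NECESSARY (it follows from the crux modulo 19236's first two conjuncts).  So modulo `MuSplitInputs` the
line is TIGHT on `19235 ∧ 19234|partnered` and over-reaches on `19234 ∖ partnered`; both parts are
instances of Greenberg's Conj. 1.11 and neither is in print (cell records: MEMO-an §15/§17,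
MU-CRUX-STRUCTURE-p2g2 §2–§4, DUAL-LENS-NULL L1–L9).  No statement item is created or changed here
(D-0014/D-0019: that is the planner's call).

References: M. Emerton, R. Pollack, T. Weston, Invent. Math. 163 (2006) Thm. 1 [EmertonPollackWeston2006];
R. Greenberg, V. Vatsal, Invent. Math. 142 (2000) §3 Rem. (3.4) [GreenbergVatsal2000]; R. Greenberg,
LNM 1716 (1999) Conj. 1.11 [GreenbergLNM1716].
-/

-- the summit and its single problem are both named `BirchSwinnertonDyer` (registry layout D-0017)
set_option linter.dupNamespace false

set_option autoImplicit false

noncomputable section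

open scoped Classical MatrixGroups ModularForm

open CongruenceSubgroup WeierstrassCurve Literature.NumberTheory.EllipticCurves
  Literature.NumberTheory.EllipticCurves.ModularForms
  Literature.NumberTheory.EllipticCurves.GreenbergVatsal2000

namespace Summit.BirchSwinnertonDyer.BirchSwinnertonDyer.Rank1Residual

/-- **Reverse transfer: the crux forces the `ϖ`-normalised certificate on every good-ordinary curve
congruent mod `p` to an X9 pair.**  Modulo Emerton–Pollack–Weston 2006 Thm. 1 (`hEPW`, analytic half,
tree transcription `thm1_muAn_transfer_of_torsionIso`) and the period unit `Ω_W = u·Ω⁺_f`, `‖u‖_p = 1`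
at irreducible `p ≥ 5` (`h5`): if `AnalyticMuZeroOnClassX9` holds, then for every globally minimal
elliptic `A/ℚ` with good ordinary reduction at `p`, every X9 pair `(W, p)` and every `Γ_ℚ`-equivariant
additive isomorphism `e : A[p] ≃ W[p]`, every newform `f_A` of `A` at level `N_A` and every `ϖ ∈ ℚ` with
`ϖ·Ω_A = Ω⁺_{f_A}`, some coefficient of `ϖ·L_p(f_A, α_A)` is a `p`-adic unit.  Proof: the crux at the
newform of `W` (level `N_W`) gives a unit coefficient of `L_p(f_W, α_W)`; `‖ϖ_W‖_p = 1`
(`norm_periodRatio_eq_one`) puts it in EPW's `ϖ`-normalised shape; EPW along `e⁻¹` (irreducibility on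
`W[p]`, from X9) transports it to `A`.  No CM hypothesis, no Carayol.  Bookkeeping; credits nothing.
[cite: EmertonPollackWeston2006, Thm. 1 (arXiv:math/0404484 p. 2)] [cite: GreenbergVatsal2000, §3, Rem. 3.4] -/
theorem muAnZero_of_congruent_classX9_of_analyticMuZeroOnClassX9
    (hEPW : EmertonPollackWeston2006.thm1_muAn_transfer_of_torsionIso)
    (h5 : realPeriodRat_eq_unit_mul_plusPeriod) (hA : AnalyticMuZeroOnClassX9)
    (A : WeierstrassCurve ℚ) [A.IsElliptic] [A.IsGloballyMinimal] (p : ℕ) [Fact p.Prime]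
    (hgoodA : A.HasGoodReductionAtPrime p) (hordA : ¬ (p : ℤ) ∣ A.frobeniusTrace p)
    (W : WeierstrassCurve ℚ) [W.IsElliptic] [W.IsGloballyMinimal] (hX9 : ClassX9 W p)
    (e : geomTorsion A (p : ℤ) ≃+ geomTorsion W (p : ℤ))
    (he : ∀ (σ : Field.absoluteGaloisGroup ℚ) (P : geomTorsion A (p : ℤ)), e (σ • P) = σ • e P)
    [NeZero (A.conductorNorm ℤ)] (fA : CuspForm (Gamma0 (A.conductorNorm ℤ)) 2)
    (hfA : IsNewformOf A fA) (ϖ : ℚ) (hϖ : (ϖ : ℝ) * A.realPeriodRat = plusPeriod fA) :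
    ∃ n : ℕ, ‖PowerSeries.coeff n
      (PowerSeries.C (ϖ : ℚ_[p]) * padicLFunction fA (unitRoot A p : ℚ_[p]))‖ = 1 := by
  obtain ⟨-, hp5, hgood, hord, hirr, -⟩ := id hX9
  -- the inverse isomorphism `W[p] ≃ A[p]` is equivariant as well
  have he' : ∀ (σ : Field.absoluteGaloisGroup ℚ) (Q : geomTorsion W (p : ℤ)),
      e.symm (σ • Q) = σ • e.symm Q := by
    intro σ Q
    apply e.injective
    rw [e.apply_symm_apply, he, e.apply_symm_apply]
  -- the crux at `W`, in the `ϖ`-normalised shape EPW consumes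
  have hμW : ∀ [NeZero (W.conductorNorm ℤ)] (fW : CuspForm (Gamma0 (W.conductorNorm ℤ)) 2),
      IsNewformOf W fW → ∀ (ϖW : ℚ), (ϖW : ℝ) * W.realPeriodRat = plusPeriod fW →
      ∃ n : ℕ, ‖PowerSeries.coeff n
        (PowerSeries.C (ϖW : ℚ_[p]) * padicLFunction fW (unitRoot W p : ℚ_[p]))‖ = 1 := by
    intro _ fW hfW ϖW hϖW
    obtain ⟨n, hn⟩ := hA W p fW hX9 hfW
    refine ⟨n, ?_⟩
    rw [PowerSeries.coeff_C_mul, norm_mul,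
      Literature.NumberTheory.EllipticCurves.Rank1Residual.norm_periodRatio_eq_one h5 W p hp5 hgood hirr
        fW hfW ϖW hϖW, one_mul]
    exact hn
  exact hEPW W A p hp5 hgood hord hgoodA hordA ⟨e.symm, he'⟩ hirr hμW fA hfA ϖ hϖ

/-- **The D1 seam with stub 1 weakened to the PARTNERED CM pairs.**  Hypotheses: `h1'` = item 19234
`MuZeroCMCurves` RESTRICTED to the CM pairs `(A, p)` that partner some X9 pair (`∃ W`, X9 at `p`, with a
`Γ_ℚ`-equivariant `A[p] ≃ W[p]`); `h2` = item 19235 `AnalyticMuZeroX9NoCMPartner` verbatim; `h3` = item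
19236 `MuSplitInputs` verbatim (EPW Thm. 1 ∧ period unit ∧ Carayol).  Conclusion: the crux's signature
`AnalyticMuZeroOnClassX9`.  Proof: the planner's seam `analyticMuZeroOnClassX9_of_cmSplit` verbatim, the
partner witness `(W, e)` threaded into `h1'` — i.e. the composition never evaluates stub 1 off the
partnered pairs.  CONDITIONAL composition — credits nothing toward closure.
[cite: EmertonPollackWeston2006, Thm. 1 (arXiv:math/0404484 p. 2)] [cite: GreenbergVatsal2000, §3, Rem. 3.4] -/
theorem analyticMuZeroOnClassX9_of_partneredCMSplit
    (h1' : ∀ (A : WeierstrassCurve ℚ) [A.IsElliptic] [A.IsGloballyMinimal] (p : ℕ) [Fact p.Prime],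
      5 ≤ p → A.j ∈ Literature.NumberTheory.EllipticCurves.maximalCMJInvariants →
      A.HasGoodReductionAtPrime p → ¬ (p : ℤ) ∣ A.frobeniusTrace p →
      A.HasIrreducibleModPGaloisRep p →
      (∃ (W : WeierstrassCurve ℚ) (_ : W.IsElliptic) (_ : W.IsGloballyMinimal),
        Summit.BirchSwinnertonDyer.BirchSwinnertonDyer.Rank1Residual.ClassX9 W p ∧
        ∃ e : WeierstrassCurve.geomTorsion A (p : ℤ) ≃+ WeierstrassCurve.geomTorsion W (p : ℤ),
          ∀ (σ : Field.absoluteGaloisGroup ℚ) (P : WeierstrassCurve.geomTorsion A (p : ℤ)),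
            e (σ • P) = σ • e P) →
      ∀ [NeZero (A.conductorNorm ℤ)]
        (fA : CuspForm (CongruenceSubgroup.Gamma0 (A.conductorNorm ℤ)) 2),
        Literature.NumberTheory.EllipticCurves.ModularForms.IsNewformOf A fA → ∀ (ϖ : ℚ),
        (ϖ : ℝ) * A.realPeriodRat = Literature.NumberTheory.EllipticCurves.ModularForms.plusPeriod fA →
        ∃ n : ℕ, ‖PowerSeries.coeff n (PowerSeries.C (ϖ : ℚ_[p]) *
          Literature.NumberTheory.EllipticCurves.padicLFunction fA
            (Literature.NumberTheory.EllipticCurves.unitRoot A p : ℚ_[p]))‖ = 1)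
    (h2 : ∀ (W : WeierstrassCurve ℚ) [W.IsElliptic] [W.IsGloballyMinimal] (p : ℕ) [Fact p.Prime]
      {N : ℕ} [NeZero N] (f : CuspForm (CongruenceSubgroup.Gamma0 N) 2),
      Summit.BirchSwinnertonDyer.BirchSwinnertonDyer.Rank1Residual.ClassX9 W p →
      ¬ (∃ (A : WeierstrassCurve ℚ) (_ : A.IsElliptic) (_ : A.IsGloballyMinimal),
          A.j ∈ Literature.NumberTheory.EllipticCurves.maximalCMJInvariants ∧
          A.HasGoodReductionAtPrime p ∧ ¬ (p : ℤ) ∣ A.frobeniusTrace p ∧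
          ∃ e : WeierstrassCurve.geomTorsion A (p : ℤ) ≃+ WeierstrassCurve.geomTorsion W (p : ℤ),
            ∀ (σ : Field.absoluteGaloisGroup ℚ) (P : WeierstrassCurve.geomTorsion A (p : ℤ)),
              e (σ • P) = σ • e P) →
      Literature.NumberTheory.EllipticCurves.ModularForms.IsNewformOf W f →
      ∃ n : ℕ, ‖PowerSeries.coeff n (Literature.NumberTheory.EllipticCurves.padicLFunction f
        (Literature.NumberTheory.EllipticCurves.unitRoot W p : ℚ_[p]))‖ = 1)
    (h3 : Literature.NumberTheory.EllipticCurves.EmertonPollackWeston2006.thm1_muAn_transfer_of_torsionIso ∧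
      Literature.NumberTheory.EllipticCurves.realPeriodRat_eq_unit_mul_plusPeriod ∧
      (∀ (N : ℕ) [NeZero N],
        Literature.NumberTheory.EllipticCurves.ModularForms.IsNewformOf.level_eq_conductorNorm (N := N))) :
    AnalyticMuZeroOnClassX9 := by
  obtain ⟨hEPW, hA25, hCar⟩ := h3
  unfold AnalyticMuZeroOnClassX9
  intro W _ _ p _ N _ f hX9 hf
  by_cases hP : ∃ (A : WeierstrassCurve ℚ) (_ : A.IsElliptic) (_ : A.IsGloballyMinimal),
      A.j ∈ Literature.NumberTheory.EllipticCurves.maximalCMJInvariants ∧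
      A.HasGoodReductionAtPrime p ∧ ¬ (p : ℤ) ∣ A.frobeniusTrace p ∧
      ∃ e : WeierstrassCurve.geomTorsion A (p : ℤ) ≃+ WeierstrassCurve.geomTorsion W (p : ℤ),
        ∀ (σ : Field.absoluteGaloisGroup ℚ) (P : WeierstrassCurve.geomTorsion A (p : ℤ)),
          e (σ • P) = σ • e P
  · obtain ⟨A, hAE, hAM, hjA, hgoodA, hordA, e, he⟩ := hP
    obtain ⟨-, h5, hgood, hord, hirr, -⟩ := id hX9
    -- the inverse isomorphism is equivariant as well
    have he' : ∀ (σ : Field.absoluteGaloisGroup ℚ) (Q : geomTorsion W (p : ℤ)),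
        e.symm (σ • Q) = σ • e.symm Q := by
      intro σ Q
      apply e.injective
      rw [e.apply_symm_apply, he, e.apply_symm_apply]
    have hirrA : A.HasIrreducibleModPGaloisRep p :=
      hasIrreducibleModPGaloisRep_of_torsionIso e.symm he' hirr
    -- Carayol: the newform of `W` lives at level `N_W`
    have hN : N = W.conductorNorm ℤ := hCar N hf
    subst hN
    -- the period unit for `W`
    obtain ⟨u, hu, hΩ⟩ := hA25 W p h5 hgood hirr f hf
    have hu0 : (u : ℚ_[p]) ≠ 0 := by
      intro h0
      rw [h0, norm_zero] at hu
      exact zero_ne_one hu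
    have hu0' : u ≠ 0 := by
      intro h0
      exact hu0 (by rw [h0]; push_cast; rfl)
    have hϖ : ((u⁻¹ : ℚ) : ℝ) * W.realPeriodRat = plusPeriod f := by
      rw [hΩ]
      push_cast
      rw [← mul_assoc, inv_mul_cancel₀ (by exact_mod_cast hu0'), one_mul]
    -- stub 1 at the PARTNERED pair `(A, p)` (witness `W`, `e`), in the shape EPW consumes
    have hμA : ∀ [NeZero (A.conductorNorm ℤ)] (fA : CuspForm (Gamma0 (A.conductorNorm ℤ)) 2),
        IsNewformOf A fA → ∀ (ϖ : ℚ), (ϖ : ℝ) * A.realPeriodRat = plusPeriod fA →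
        ∃ n : ℕ, ‖PowerSeries.coeff n
          (PowerSeries.C (ϖ : ℚ_[p]) * padicLFunction fA (unitRoot A p : ℚ_[p]))‖ = 1 := by
      intro _ fA hfA ϖ hϖA
      exact h1' A p h5 hjA hgoodA hordA hirrA ⟨W, ‹_›, ‹_›, hX9, e, he⟩ fA hfA ϖ hϖA
    obtain ⟨n, hn⟩ :=
      hEPW A W p h5 hgoodA hordA hgood hord ⟨e, he⟩ hirrA hμA f hf (u⁻¹ : ℚ) hϖ
    refine ⟨n, ?_⟩
    have hnorm : ‖((u⁻¹ : ℚ) : ℚ_[p])‖ = 1 := by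
      push_cast
      rw [norm_inv, hu, inv_one]
    rw [PowerSeries.coeff_C_mul, norm_mul, hnorm, one_mul] at hn
    exact hn
  · exact h2 W p f hX9 hP hf

end Summit.BirchSwinnertonDyer.BirchSwinnertonDyer.Rank1Residual


namespace Summit.BirchSwinnertonDyer.BirchSwinnertonDyer.Theorems

open Summit.BirchSwinnertonDyer.BirchSwinnertonDyer.Theses.SmallImageMuTransfer

/-- **Stub 2 is a sub-statement of the crux, BY NAME**: `AnalyticMuZeroX9 → AnalyticMuZeroX9NoCMPartner`
(item 19630 ⟹ item 19235; the no-partner hypothesis is simply dropped).  So on its own pairs stub 2 is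
exactly as hard as the crux; no input is used.  Bookkeeping. [cite: GreenbergLNM1716, §1 Conj. 1.11] -/
theorem smallImageMuTransfer_analyticMuZeroX9NoCMPartner_of_analyticMuZeroX9
    (h : AnalyticMuZeroX9) : AnalyticMuZeroX9NoCMPartner := by
  unfold Summit.BirchSwinnertonDyer.BirchSwinnertonDyer.Theses.SmallImageMuTransfer.AnalyticMuZeroX9NoCMPartner
  unfold Summit.BirchSwinnertonDyer.BirchSwinnertonDyer.Theses.SmallImageMuTransfer.AnalyticMuZeroX9
    Summit.BirchSwinnertonDyer.BirchSwinnertonDyer.Rank1Residual.AnalyticMuZeroOnClassX9 at h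
  intro W _ _ p _ N _ f hX9 _ hf
  exact h W p f hX9 hf

/-- **The crux forces stub 1 on the PARTNERED CM pairs, BY NAME** (modulo the first two conjuncts of item
19236 `MuSplitInputs`: EPW 2006 Thm. 1 and the period unit): `AnalyticMuZeroX9` ⟹ `MuZeroCMCurves` with
the extra hypothesis «`(A, p)` partners some X9 pair» — the part of item 19234 that line `d1_byname`
actually consumes is NECESSARY.  (`Rank1Residual.muAnZero_of_congruent_classX9_of_analyticMuZeroOnClassX9`;
the CM and irreducibility hypotheses are not even used.)  Bookkeeping; credits nothing.
[cite: EmertonPollackWeston2006, Thm. 1 (arXiv:math/0404484 p. 2)] [cite: GreenbergVatsal2000, §3, Rem. 3.4] -/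
theorem smallImageMuTransfer_muZeroCMCurves_partnered_of_analyticMuZeroX9
    (hEPW : EmertonPollackWeston2006.thm1_muAn_transfer_of_torsionIso)
    (h5 : realPeriodRat_eq_unit_mul_plusPeriod) (h : AnalyticMuZeroX9) :
    ∀ (A : WeierstrassCurve ℚ) [A.IsElliptic] [A.IsGloballyMinimal] (p : ℕ) [Fact p.Prime],
      5 ≤ p → A.j ∈ Literature.NumberTheory.EllipticCurves.maximalCMJInvariants →
      A.HasGoodReductionAtPrime p → ¬ (p : ℤ) ∣ A.frobeniusTrace p →
      A.HasIrreducibleModPGaloisRep p →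
      (∃ (W : WeierstrassCurve ℚ) (_ : W.IsElliptic) (_ : W.IsGloballyMinimal),
        Summit.BirchSwinnertonDyer.BirchSwinnertonDyer.Rank1Residual.ClassX9 W p ∧
        ∃ e : WeierstrassCurve.geomTorsion A (p : ℤ) ≃+ WeierstrassCurve.geomTorsion W (p : ℤ),
          ∀ (σ : Field.absoluteGaloisGroup ℚ) (P : WeierstrassCurve.geomTorsion A (p : ℤ)),
            e (σ • P) = σ • e P) →
      ∀ [NeZero (A.conductorNorm ℤ)]
        (fA : CuspForm (CongruenceSubgroup.Gamma0 (A.conductorNorm ℤ)) 2),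
        Literature.NumberTheory.EllipticCurves.ModularForms.IsNewformOf A fA → ∀ (ϖ : ℚ),
        (ϖ : ℝ) * A.realPeriodRat = Literature.NumberTheory.EllipticCurves.ModularForms.plusPeriod fA →
        ∃ n : ℕ, ‖PowerSeries.coeff n (PowerSeries.C (ϖ : ℚ_[p]) *
          Literature.NumberTheory.EllipticCurves.padicLFunction fA
            (Literature.NumberTheory.EllipticCurves.unitRoot A p : ℚ_[p]))‖ = 1 := by
  intro A _ _ p _ _ _ hgoodA hordA _ hP _ fA hfA ϖ hϖ
  obtain ⟨W, hWE, hWM, hX9, e, he⟩ := hP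
  exact Summit.BirchSwinnertonDyer.BirchSwinnertonDyer.Rank1Residual.muAnZero_of_congruent_classX9_of_analyticMuZeroOnClassX9
    hEPW h5 h A p hgoodA hordA W hX9 e he fA hfA ϖ hϖ

/-- **The exact strength of line `d1_byname`, BY NAME.**  Modulo item 19236 `MuSplitInputs` (EPW 2006
Thm. 1 ∧ period unit ∧ Carayol, cite-only):
`AnalyticMuZeroX9 ↔ AnalyticMuZeroX9NoCMPartner ∧ (MuZeroCMCurves restricted to the partnered CM pairs)`.
`→`: the two theorems above; `←`: `Rank1Residual.analyticMuZeroOnClassX9_of_partneredCMSplit` (the D1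
seam with stub 1 weakened).  Hence the filed split D1 (`⟸ 19234 ∧ 19235 ∧ 19236`) is tight on
`19235 ∧ 19234|partnered` and over-reaches by the un-partnered instances of 19234 — all of them instances
of Greenberg's Conj. 1.11; bookkeeping for the planner, no item is created or changed here.
[cite: EmertonPollackWeston2006, Thm. 1 (arXiv:math/0404484 p. 2)] [cite: GreenbergLNM1716, §1 Conj. 1.11] -/
theorem smallImageMuTransfer_analyticMuZeroX9_iff_noCMPartner_and_partneredCM (h3 : MuSplitInputs) :
    AnalyticMuZeroX9 ↔
      (AnalyticMuZeroX9NoCMPartner ∧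
        ∀ (A : WeierstrassCurve ℚ) [A.IsElliptic] [A.IsGloballyMinimal] (p : ℕ) [Fact p.Prime],
          5 ≤ p → A.j ∈ Literature.NumberTheory.EllipticCurves.maximalCMJInvariants →
          A.HasGoodReductionAtPrime p → ¬ (p : ℤ) ∣ A.frobeniusTrace p →
          A.HasIrreducibleModPGaloisRep p →
          (∃ (W : WeierstrassCurve ℚ) (_ : W.IsElliptic) (_ : W.IsGloballyMinimal),
            Summit.BirchSwinnertonDyer.BirchSwinnertonDyer.Rank1Residual.ClassX9 W p ∧
            ∃ e : WeierstrassCurve.geomTorsion A (p : ℤ) ≃+ WeierstrassCurve.geomTorsion W (p : ℤ),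
              ∀ (σ : Field.absoluteGaloisGroup ℚ) (P : WeierstrassCurve.geomTorsion A (p : ℤ)),
                e (σ • P) = σ • e P) →
          ∀ [NeZero (A.conductorNorm ℤ)]
            (fA : CuspForm (CongruenceSubgroup.Gamma0 (A.conductorNorm ℤ)) 2),
            Literature.NumberTheory.EllipticCurves.ModularForms.IsNewformOf A fA → ∀ (ϖ : ℚ),
            (ϖ : ℝ) * A.realPeriodRat =
              Literature.NumberTheory.EllipticCurves.ModularForms.plusPeriod fA →
            ∃ n : ℕ, ‖PowerSeries.coeff n (PowerSeries.C (ϖ : ℚ_[p]) *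
              Literature.NumberTheory.EllipticCurves.padicLFunction fA
                (Literature.NumberTheory.EllipticCurves.unitRoot A p : ℚ_[p]))‖ = 1) := by
  have h3' := h3
  unfold Summit.BirchSwinnertonDyer.BirchSwinnertonDyer.Theses.SmallImageMuTransfer.MuSplitInputs at h3'
  constructor
  · intro h
    exact ⟨smallImageMuTransfer_analyticMuZeroX9NoCMPartner_of_analyticMuZeroX9 h,
      smallImageMuTransfer_muZeroCMCurves_partnered_of_analyticMuZeroX9 h3'.1 h3'.2.1 h⟩
  · rintro ⟨h2, h1'⟩
    unfold Summit.BirchSwinnertonDyer.BirchSwinnertonDyer.Theses.SmallImageMuTransfer.AnalyticMuZeroX9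
    unfold Summit.BirchSwinnertonDyer.BirchSwinnertonDyer.Theses.SmallImageMuTransfer.AnalyticMuZeroX9NoCMPartner
      at h2
    exact Summit.BirchSwinnertonDyer.BirchSwinnertonDyer.Rank1Residual.analyticMuZeroOnClassX9_of_partneredCMSplit
      h1' h2 h3'

end Summit.BirchSwinnertonDyer.BirchSwinnertonDyer.Theorems


/-! ### Appended (lead gen 2): stub 1 is only ever consumed at `p ∈ {5, 7}` (modulo BPR 2013 + BDMTV 2019) -/

namespace Summit.BirchSwinnertonDyer.BirchSwinnertonDyer.Rank1Residual

/-- **The D1 seam with stub 1 weakened to the PARTNERED CM pairs AT `p ∈ {5, 7}`**, modulo the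
split-Cartan classification `hBDMTV` (tree fact `BalakrishnanEtAl2019.thm12_not_le_normalizer_splitCartan`,
BPR 2013 Cor. 1.2 + BDMTV 2019 Thm. 1.1; binder only): a CM pair can partner an X9 pair only at an X9
prime, and X9 lives at `p ∈ {5, 7}` modulo `hBDMTV` (`ClassX9.eq_five_or_eq_seven_of_thm12`), so `h1''` =
item 19234 with `5 ≤ p` replaced by `p = 5 ∨ p = 7` AND the partner clause feeds
`analyticMuZeroOnClassX9_of_partneredCMSplit`.  Every split `p ≥ 11` in item 19234 is dead weight for
line `d1_byname`; which `j` survive at `5`/`7` (`p` split in the CM field: `j ∈ {1728, −32768, −884736}`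
at `5`, `j ∈ {0, −884736}` at `7`, Deuring) is prose only.  CONDITIONAL composition — credits nothing.
[cite: BiluParentRebolledo2013, Cor. 1.2] [cite: BalakrishnanEtAl2019, Thm. 1.1] [cite: EmertonPollackWeston2006, Thm. 1] -/
theorem analyticMuZeroOnClassX9_of_partneredCMSplit57_of_thm12
    (hBDMTV : BalakrishnanEtAl2019.thm12_not_le_normalizer_splitCartan)
    (h1'' : ∀ (A : WeierstrassCurve ℚ) [A.IsElliptic] [A.IsGloballyMinimal] (p : ℕ) [Fact p.Prime],
      (p = 5 ∨ p = 7) → A.j ∈ Literature.NumberTheory.EllipticCurves.maximalCMJInvariants →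
      A.HasGoodReductionAtPrime p → ¬ (p : ℤ) ∣ A.frobeniusTrace p →
      A.HasIrreducibleModPGaloisRep p →
      (∃ (W : WeierstrassCurve ℚ) (_ : W.IsElliptic) (_ : W.IsGloballyMinimal),
        Summit.BirchSwinnertonDyer.BirchSwinnertonDyer.Rank1Residual.ClassX9 W p ∧
        ∃ e : WeierstrassCurve.geomTorsion A (p : ℤ) ≃+ WeierstrassCurve.geomTorsion W (p : ℤ),
          ∀ (σ : Field.absoluteGaloisGroup ℚ) (P : WeierstrassCurve.geomTorsion A (p : ℤ)),
            e (σ • P) = σ • e P) →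
      ∀ [NeZero (A.conductorNorm ℤ)]
        (fA : CuspForm (CongruenceSubgroup.Gamma0 (A.conductorNorm ℤ)) 2),
        Literature.NumberTheory.EllipticCurves.ModularForms.IsNewformOf A fA → ∀ (ϖ : ℚ),
        (ϖ : ℝ) * A.realPeriodRat = Literature.NumberTheory.EllipticCurves.ModularForms.plusPeriod fA →
        ∃ n : ℕ, ‖PowerSeries.coeff n (PowerSeries.C (ϖ : ℚ_[p]) *
          Literature.NumberTheory.EllipticCurves.padicLFunction fA
            (Literature.NumberTheory.EllipticCurves.unitRoot A p : ℚ_[p]))‖ = 1)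
    (h2 : ∀ (W : WeierstrassCurve ℚ) [W.IsElliptic] [W.IsGloballyMinimal] (p : ℕ) [Fact p.Prime]
      {N : ℕ} [NeZero N] (f : CuspForm (CongruenceSubgroup.Gamma0 N) 2),
      Summit.BirchSwinnertonDyer.BirchSwinnertonDyer.Rank1Residual.ClassX9 W p →
      ¬ (∃ (A : WeierstrassCurve ℚ) (_ : A.IsElliptic) (_ : A.IsGloballyMinimal),
          A.j ∈ Literature.NumberTheory.EllipticCurves.maximalCMJInvariants ∧
          A.HasGoodReductionAtPrime p ∧ ¬ (p : ℤ) ∣ A.frobeniusTrace p ∧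
          ∃ e : WeierstrassCurve.geomTorsion A (p : ℤ) ≃+ WeierstrassCurve.geomTorsion W (p : ℤ),
            ∀ (σ : Field.absoluteGaloisGroup ℚ) (P : WeierstrassCurve.geomTorsion A (p : ℤ)),
              e (σ • P) = σ • e P) →
      Literature.NumberTheory.EllipticCurves.ModularForms.IsNewformOf W f →
      ∃ n : ℕ, ‖PowerSeries.coeff n (Literature.NumberTheory.EllipticCurves.padicLFunction f
        (Literature.NumberTheory.EllipticCurves.unitRoot W p : ℚ_[p]))‖ = 1)
    (h3 : Literature.NumberTheory.EllipticCurves.EmertonPollackWeston2006.thm1_muAn_transfer_of_torsionIso ∧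
      Literature.NumberTheory.EllipticCurves.realPeriodRat_eq_unit_mul_plusPeriod ∧
      (∀ (N : ℕ) [NeZero N],
        Literature.NumberTheory.EllipticCurves.ModularForms.IsNewformOf.level_eq_conductorNorm (N := N))) :
    AnalyticMuZeroOnClassX9 := by
  refine analyticMuZeroOnClassX9_of_partneredCMSplit ?_ h2 h3
  intro A _ _ p _ _ hjA hgoodA hordA hirrA hP _ fA hfA ϖ hϖ
  obtain ⟨W, hWE, hWM, hX9, e, he⟩ := hP
  have hp57 : p = 5 ∨ p = 7 := ClassX9.eq_five_or_eq_seven_of_thm12 hBDMTV W p hX9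
  exact h1'' A p hp57 hjA hgoodA hordA hirrA ⟨W, hWE, hWM, hX9, e, he⟩ fA hfA ϖ hϖ

end Summit.BirchSwinnertonDyer.BirchSwinnertonDyer.Rank1Residual
namespace Summit.BirchSwinnertonDyer.BirchSwinnertonDyer.Theorems
open Summit.BirchSwinnertonDyer.BirchSwinnertonDyer.Theses.SmallImageMuTransfer in
/-- **What line `d1_byname` needs from item 19234, BY NAME** (modulo item 19236 `MuSplitInputs` and
`hBDMTV`): the crux follows from item 19235 and `MuZeroCMCurves` RESTRICTED to the partnered CM pairs at
`p ∈ {5, 7}` (necessary too: `smallImageMuTransfer_muZeroCMCurves_partnered_of_analyticMuZeroX9`).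
Bookkeeping for the planner; no item is created or changed here; 19234/19235 stay OPEN.
[cite: BiluParentRebolledo2013, Cor. 1.2] [cite: BalakrishnanEtAl2019, Thm. 1.1] [cite: GreenbergLNM1716, §1 Conj. 1.11] -/
theorem smallImageMuTransfer_analyticMuZeroX9_of_noCMPartner_of_partneredCM57_of_thm12
    (hBDMTV : BalakrishnanEtAl2019.thm12_not_le_normalizer_splitCartan) (h3 : MuSplitInputs)
    (h2 : AnalyticMuZeroX9NoCMPartner)
    (h1'' : ∀ (A : WeierstrassCurve ℚ) [A.IsElliptic] [A.IsGloballyMinimal] (p : ℕ) [Fact p.Prime],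
      (p = 5 ∨ p = 7) → A.j ∈ Literature.NumberTheory.EllipticCurves.maximalCMJInvariants →
      A.HasGoodReductionAtPrime p → ¬ (p : ℤ) ∣ A.frobeniusTrace p →
      A.HasIrreducibleModPGaloisRep p →
      (∃ (W : WeierstrassCurve ℚ) (_ : W.IsElliptic) (_ : W.IsGloballyMinimal),
        Summit.BirchSwinnertonDyer.BirchSwinnertonDyer.Rank1Residual.ClassX9 W p ∧
        ∃ e : WeierstrassCurve.geomTorsion A (p : ℤ) ≃+ WeierstrassCurve.geomTorsion W (p : ℤ),
          ∀ (σ : Field.absoluteGaloisGroup ℚ) (P : WeierstrassCurve.geomTorsion A (p : ℤ)),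
            e (σ • P) = σ • e P) →
      ∀ [NeZero (A.conductorNorm ℤ)]
        (fA : CuspForm (CongruenceSubgroup.Gamma0 (A.conductorNorm ℤ)) 2),
        Literature.NumberTheory.EllipticCurves.ModularForms.IsNewformOf A fA → ∀ (ϖ : ℚ),
        (ϖ : ℝ) * A.realPeriodRat = Literature.NumberTheory.EllipticCurves.ModularForms.plusPeriod fA →
        ∃ n : ℕ, ‖PowerSeries.coeff n (PowerSeries.C (ϖ : ℚ_[p]) *
          Literature.NumberTheory.EllipticCurves.padicLFunction fA
            (Literature.NumberTheory.EllipticCurves.unitRoot A p : ℚ_[p]))‖ = 1) :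
    AnalyticMuZeroX9 := by
  have h3' := h3
  unfold Summit.BirchSwinnertonDyer.BirchSwinnertonDyer.Theses.SmallImageMuTransfer.MuSplitInputs at h3'
  unfold Summit.BirchSwinnertonDyer.BirchSwinnertonDyer.Theses.SmallImageMuTransfer.AnalyticMuZeroX9
  unfold Summit.BirchSwinnertonDyer.BirchSwinnertonDyer.Theses.SmallImageMuTransfer.AnalyticMuZeroX9NoCMPartner
    at h2
  exact Summit.BirchSwinnertonDyer.BirchSwinnertonDyer.Rank1Residual.analyticMuZeroOnClassX9_of_partneredCMSplit57_of_thm12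
    hBDMTV h1'' h2 h3'

end Summit.BirchSwinnertonDyer.BirchSwinnertonDyer.Theorems

end
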